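import Summits.QuantumFields.YangMills.Theses.ContractibleFibre

/-!
# Birth skeleton (BC3) for crux `FibreAnchor` (stmt-QuantumFields-16243) — `Lines/birth.lean`

Registrar: `planner-skel-stmt-QuantumFields-16243-0` (skeleton-register one-shot; route
`route-QuantumFields-ContractibleFibre`, re-audit bin REPAIRABLE), 2026-08-17.

Crux (route file `Theses/ContractibleFibre.lean`, decl
`Summit.QuantumFields.YangMills.Theses.ContractibleFibre.FibreAnchor`, rank 3, XL): for every compact
simple `G`, faithful unitary `r` and EVERY fibre width `M` there are `β₀(M)` and a β-UNIFORM rate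
`m₀(M) > 0` such that for all `β ≥ β₀(M)` and every slab width `w` there are `C` and a volume floor
`L_min` with: on every free tube `(ℤ/L)²×{0..M}²`, `L ≥ L_min`, every pair of bounded measurable
time-slab observables clusters in time, `|E[F₁·F₂∘σ_n] − E[F₁]E[F₂∘σ_n]| ≤ C e^(−m₀ n)` for `2n < L`
(Wilson weight `exp(β Σ ins·Re tr r.ρ(U_P))` w.r.t. product Haar; the fibre plaquettes that would wrap
`Fin (M+1)` carry `ins = 0` = free boundary).

## The cut: SMALL FIELDS FIRST, THEN LARGE FIELDS (the route's own Two-layer plan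
"FibreAnchor ⇐ SmallFieldQuiver → LargeFieldPeierls", typed)

* `stub_smallFieldAnchor` (S — THE PERTURBATIVE CORE MADE HONEST; hardest, open). Insert into the
  Gibbs weight the indicator `χ_η` of the SMALL-FIELD event
  `sf_η = {U | every WEIGHTED plaquette has N − Re tr r.ρ(U_P) ≤ η}` (`N = r.N = Re tr r.ρ(1)`; the
  unweighted wrap-around fibre plaquettes are NOT constrained), i.e. replace `Ex F = ∫F·wgt/∫wgt` by the
  conditioned mean `Ex_η F = ∫F·χ_η·wgt/∫χ_η·wgt` — Bałaban's small-field theory of the free tube, still a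
  nearest-neighbour plaquette model (single-plaquette weight `e^{β Re tr}·𝟙{e_P ≤ η}`), site-reflection
  positive in time. CLAIM: for every `M` there is `η₀(M) > 0` such that for every `0 < η ≤ η₀` there are
  `β₀(M,η)` and a β-UNIFORM rate `m₀ > 0` with: for all `β ≥ β₀`, all `w`, some `C`, `L_min`, the
  conditioned free tube clusters time-slab observables at rate `m₀` on all `L ≥ L_min`, `2n < L`
  (verbatim the crux's clustering clause with `Ex_η` for `Ex`). Mechanism: on `sf_η` the fibre is
  contractible, so complete tree gauge in the fibre has no Gribov problem and exhibits the tube as a 2-d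
  `G^{(M+1)²}` quiver gauge theory Higgsed to the diagonal `G` (fibre tree links = frozen bifundamentals):
  KK vector/scalar modes with tree-level fibre-Laplacian mass² `≥ λ₁ = 2 − 2cos(π/(M+1))` (decay rate
  `arccosh(1 + λ₁/2)`, the 2001 Gaussian shadow) INDEPENDENT of β,
  uniformly convex action transverse to gauge orbits (H¹(square) = 0), plus the unbroken 2-d diagonal `G`
  gauge field (no local degrees of freedom; its torelon / global-constraint sector has mass `σ₂(β,η)·L`,
  `σ₂ ≍ C₂(r)/(2βN)`, pushed above `m₀` by the floor `L_min(β) ≍ m₀/σ₂`). Why it might fail: β-uniform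
  control of the adjoint KK matter coupled to the CONFINING 2-d diagonal gauge field (W-pair states
  accumulating at threshold as `σ₂ → 0`) is not a convergent expansion on record even with large fields
  removed; `β₀(M,η)` must exceed `≍ 1/η` so that the constraint only removes atypical fields.
* `stub_largeFieldStability` (P — LARGE FIELDS ARE DILUTE DEFECTS; L/XL). For every `M`: IF the
  small-field anchor holds at `M` (verbatim S's conclusion at `M`), THEN the crux's body holds at `M`
  (verbatim). Mechanism: a weighted plaquette with `e_P > η` costs `e^{−βη/2}` against entropy
  `β^{O(dim G)}` (chessboard / Peierls estimate in the two long RP directions, uniformly in `L`), so at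
  `β ≥ β₀'(M,η)` the full measure is the conditioned one perturbed by a dilute hard-core gas of
  large-field defects with activity `→ 0` as `β → ∞`; a polymer expansion in the defects around the
  small-field theory transports the β-uniform rate (any `m₀' < m₀`). Why it might fail: "uniformly mixing
  reference system + dilute local perturbation ⇒ mixing" is not a general theorem — the expansion needs
  S in a robust conditioned/local form (in practice one re-enters S's expansion with large-field holes),
  and odd `L` has no chessboard; Pirogov–Sinai-type metastability of centre-element link patterns for
  `SU(N ≥ 5)` / large `r` sits exactly here.
* `FibreAnchor_of : FibreAnchor` — the composition, stubs BY NAME: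
  `fun G _ _ _ _ hG r M => stub_largeFieldStability G hG r M (stub_smallFieldAnchor G hG r M)`; the
  `example` after it is the same glue with the two stub STATEMENTS as anonymous hypotheses
  (`S-statement → P-statement → FibreAnchor`, sorry-free), and the last `example` certifies that the
  registered composition has literally the route decl as its type.

Neither stub is the crux or the summit in disguise: S speaks of a DIFFERENT family of measures (the
η-conditioned small-field theories, `η ≤ η₀(M)`), P is a conditional whose antecedent is S; neither
mentions OS data, schemes, `latticeConnectedCorr` or `YangMills`. BC3 probes (registrar folder `bc/`,
import = the route file; no `ContractibleFibre*` theorem has landed, so nothing else could feed `exact?`):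
`stub → FibreAnchor` and `stub → YangMills` by `first | exact? | simpa | aesop` (and the BC.md variant with
`simpa [FibreAnchor] using h` / `unfold FibreAnchor; simpa using h`) must FAIL for both stubs — raw outputs
in `Lines/birth.md`.

## Disproof used

None exists: `Cruxes/FibreAnchor/` had no workfiles before this one (no `Disproof.lean`, no registered
line, no crux idea; `ledger crux ls / ideas stmt-QuantumFields-16243`, 2026-08-17), and there is no
`Theorems/FibreAnchor/Negative/`. The summit's negatives index (5 refuted statements: RobustYangMillsRG,
DiagonalMirrorRP, AdaptiveCoarseSystem, MultibosonLatticeGap, AdmissibleRootsExist) contains nothing on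
free-tube / slab clustering; neither stub is an instance of any of them. Barriers: Borgs–Seiler
(`Literature.Barriers.QuantumFields.FiniteTemperatureDeconfinement`) concerns a thin PERIODIC direction —
both stubs keep the crux's geometry (symmetric long torus `L×L`, `2n < L`, FREE contractible fibre, no
Polyakov loop around it); `AbelianDeconfinementD4` — at fixed `M` the claim is a KK-threshold rate and is
claimed for `U(1)` too (the group-sensitive step is FibreContinuity, not this crux); `PerturbativeInvisibility`
— the rate `m₀(M)` IS perturbatively visible (a KK mass), which is why S is the perturbative core.

`lean check`: rc 0; sorries = 2 = stubs (`stub_smallFieldAnchor`, `stub_largeFieldStability`), zero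
elsewhere. Namespace `Summit.QuantumFields.YangMills.Cruxes.FibreAnchor.Birth`.
-/

set_option autoImplicit false

noncomputable section

namespace Summit.QuantumFields.YangMills.Cruxes.FibreAnchor.Birth

open scoped BigOperators
open MeasureTheory
open Summit.QuantumFields.YangMills.Theses.ContractibleFibre

/-- **Stub S — the small-field anchor (OPEN; the perturbative core, hardest piece).** For every
compact simple `G`, faithful unitary `r` and every fibre width `M` there is `η₀ > 0` such that for every
`0 < η ≤ η₀` there are `β₀` and a β-UNIFORM rate `m₀ > 0` with: for all `β ≥ β₀` and every slab width
`w` there are `C`, `L_min` such that on every free tube `(ℤ/L)²×Fin(M+1)²` with `L ≥ L_min` the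
SMALL-FIELD-CONDITIONED Wilson measure — weight `χ_η(U)·exp(β Σ_x Σ_{μ<κ} ins·Re tr r.ρ(U_P))` w.r.t.
product Haar, `χ_η` the indicator of `{U | N − Re tr r.ρ(U_P) ≤ η for every weighted plaquette P}` —
clusters every pair of bounded measurable time-slab observables in time:
`|E_η[F₁·F₂∘σ_n] − E_η[F₁]E_η[F₂∘σ_n]| ≤ C e^{−m₀ n}` for `2n < L` (same inline vocabulary as the crux,
`Ex` replaced by the conditioned ratio of integrals). -/
theorem stub_smallFieldAnchor :
    ∀ (G : Type) [Group G] [TopologicalSpace G] [IsTopologicalGroup G] [CompactSpace G], Literature.MathematicalPhysics.QuantumFieldTheory.IsCompactSimpleLieGroup G → letI : MeasurableSpace G := borel G; haveI : BorelSpace G := ⟨rfl⟩; ∀ r : Literature.MathematicalPhysics.QuantumFieldTheory.LatticeRep G, let TubeSF := fun (M : ℕ) (η β m C : ℝ) (w Lmin : ℕ) => ∀ (L : ℕ) [NeZero L], Lmin ≤ L → let St := ZMod L × ZMod L × Fin (M + 1) × Fin (M + 1); let Cfg := St × Fin 4 → G; let ν : MeasureTheory.Measure Cfg := MeasureTheory.Measure.pi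 fun _ => Literature.MathematicalPhysics.QuantumFieldTheory.haarProbability G; let sh : St → Fin 4 → St := fun x μ => ![(x.1 + 1, x.2.1, x.2.2.1, x.2.2.2), (x.1, x.2.1 + 1, x.2.2.1, x.2.2.2), (x.1, x.2.1, x.2.2.1 + 1, x.2.2.2), (x.1, x.2.1, x.2.2.1, x.2.2.2 + 1)] μ; let ins : St → Fin 4 → Fin 4 → ℝ := fun x μ κ => if ((μ = 2 ∨ κ = 2) → (x.2.2.1 : ℕ) < M) ∧ ((μ = 3 ∨ κ = 3) → (x.2.2.2 : ℕ) < M) then 1 else 0; let pl : Cfg → St → Fin 4 → Fin 4 → G := fun U x μ κ => U (x, μ) * U (sh x μ, κ) * (U (sh x κ, μ))⁻¹ * (U (x, κ))⁻¹; let act : Cfg → ℝ := fun U => β * ∑ x : St, ∑ q : {q : Fin 4 × Fin 4 // q.1 < q.2}, ins x q.1.1 q.1.2 * (r.ρ (pl U x q.1.1 q.1.2)).trace.re; let wgt : Cfg → ℝ := fun U => Real.exp (act U); let sf : Set Cfg := {U | ∀ (x : St) (q : {q : Fin 4 × Fin 4 // q.1 < q.2}), ins x q.1.1 q.1.2 =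 1 → (r.N : ℝ) - (r.ρ (pl U x q.1.1 q.1.2)).trace.re ≤ η}; let χ : Cfg → ℝ := sf.indicator fun _ => 1; let Ex : (Cfg → ℝ) → ℝ := fun F => (∫ U, F U * (χ U * wgt U) ∂ν) / (∫ U, χ U * wgt U ∂ν); let σ : ℕ → Cfg → Cfg := fun n U p => U ((p.1.1 + n, p.1.2), p.2); ∀ c : ZMod L, let Loc := fun F : Cfg → ℝ => Measurable F ∧ (∀ U, |F U| ≤ 1) ∧ ∀ U U', (∀ p : St × Fin 4, (p.1.1 - c).val ≤ w → U p = U' p) → F U = F U'; ∀ F₁ F₂ : Cfg → ℝ, Loc F₁ → Loc F₂ → ∀ n : ℕ, 2 * n < L → |Ex (fun U => F₁ U * F₂ (σ n U)) - Ex F₁ * Ex (fun U => F₂ (σ n U))| ≤ C * Real.exp (-(m * n)); ∀ M : ℕ, ∃ η₀ : ℝ, 0 < η₀ ∧ ∀ η : ℝ, 0 < η → η ≤ η₀ → ∃ β₀ m₀ : ℝ, 0 < m₀ ∧ ∀ β : ℝ, β₀ ≤ β → ∀ w : ℕ, ∃ C : ℝ, ∃ Lmin : ℕ, TubeSF M η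 β m₀ C w Lmin := by
  sorry

/-- **Stub P — large-field stability (OPEN; L/XL).** For every compact simple `G`, faithful
unitary `r` and every fibre width `M`: IF the small-field anchor holds at `M` (verbatim the conclusion
of `stub_smallFieldAnchor` at `M`: some `η₀ > 0`, and for every `0 < η ≤ η₀` a threshold `β₀`, a
β-uniform rate and constants/floors for the η-conditioned free tubes), THEN the body of the crux
`FibreAnchor` holds at `M` (verbatim: `β₀(M)`, a β-uniform `m₀(M) > 0`, and for `β ≥ β₀`, every `w`,
constants `C`, `L_min` clustering the UNCONDITIONED free tubes `L ≥ L_min`). Mechanism: Peierls /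
chessboard suppression `e^{−βη/2}·β^{O(dim G)}` of weighted plaquettes with `N − Re tr > η`, uniformly in
`L`, and a polymer expansion in these dilute large-field defects around the small-field theory. -/
theorem stub_largeFieldStability :
    ∀ (G : Type) [Group G] [TopologicalSpace G] [IsTopologicalGroup G] [CompactSpace G], Literature.MathematicalPhysics.QuantumFieldTheory.IsCompactSimpleLieGroup G → letI : MeasurableSpace G := borel G; haveI : BorelSpace G := ⟨rfl⟩; ∀ r : Literature.MathematicalPhysics.QuantumFieldTheory.LatticeRep G, let Tube := fun (M : ℕ) (β m C : ℝ) (w Lmin : ℕ) => ∀ (L : ℕ) [NeZero L], Lmin ≤ L → let St := ZMod L × ZMod L × Fin (M + 1) × Fin (M + 1); let Cfg := St × Fin 4 → G; let ν : MeasureTheory.Measure Cfg := MeasureTheory.Measure.pi fun _ => Literature.MathematicalPhysics.QuantumFieldTheory.haarProbability G; let sh : St → Fin 4 → St := fun x μ => ![(x.1 + 1, x.2.1, x.2.2.1, x.2.2.2), (x.1, x.2.1 + 1, x.2.2.1, x.2.2.2), (x.1, x.2.1, x.2.2.1 + 1, x.2.2.2), (x.1, x.2.1, x.2.2.1, x.2.2.2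 + 1)] μ; let ins : St → Fin 4 → Fin 4 → ℝ := fun x μ κ => if ((μ = 2 ∨ κ = 2) → (x.2.2.1 : ℕ) < M) ∧ ((μ = 3 ∨ κ = 3) → (x.2.2.2 : ℕ) < M) then 1 else 0; let pl : Cfg → St → Fin 4 → Fin 4 → G := fun U x μ κ => U (x, μ) * U (sh x μ, κ) * (U (sh x κ, μ))⁻¹ * (U (x, κ))⁻¹; let act : Cfg → ℝ := fun U => β * ∑ x : St, ∑ q : {q : Fin 4 × Fin 4 // q.1 < q.2}, ins x q.1.1 q.1.2 * (r.ρ (pl U x q.1.1 q.1.2)).trace.re; let wgt : Cfg → ℝ := fun U => Real.exp (act U); let Ex : (Cfg → ℝ) → ℝ := fun F => (∫ U, F U * wgt U ∂ν) / (∫ U, wgt U ∂ν); let σ : ℕ → Cfg → Cfg := fun n U p => U ((p.1.1 + n, p.1.2), p.2); ∀ c : ZMod L, let Loc := fun F : Cfg → ℝ => Measurable F ∧ (∀ U, |F U| ≤ 1) ∧ ∀ U U', (∀ p : St × Fin 4, (p.1.1 - c).val ≤ w → U p = U' p) → F U = F U'; ∀ F₁ F₂ : Cfg → ℝ, Loc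 F₁ → Loc F₂ → ∀ n : ℕ, 2 * n < L → |Ex (fun U => F₁ U * F₂ (σ n U)) - Ex F₁ * Ex (fun U => F₂ (σ n U))| ≤ C * Real.exp (-(m * n)); let TubeSF := fun (M : ℕ) (η β m C : ℝ) (w Lmin : ℕ) => ∀ (L : ℕ) [NeZero L], Lmin ≤ L → let St := ZMod L × ZMod L × Fin (M + 1) × Fin (M + 1); let Cfg := St × Fin 4 → G; let ν : MeasureTheory.Measure Cfg := MeasureTheory.Measure.pi fun _ => Literature.MathematicalPhysics.QuantumFieldTheory.haarProbability G; let sh : St → Fin 4 → St := fun x μ => ![(x.1 + 1, x.2.1, x.2.2.1, x.2.2.2), (x.1, x.2.1 + 1, x.2.2.1, x.2.2.2), (x.1, x.2.1, x.2.2.1 + 1, x.2.2.2), (x.1, x.2.1, x.2.2.1, x.2.2.2 + 1)] μ; let ins : St → Fin 4 → Fin 4 → ℝ := fun x μ κ => if ((μ = 2 ∨ κ = 2) → (x.2.2.1 : ℕ) < M) ∧ ((μ = 3 ∨ κ = 3) → (x.2.2.2 : ℕ) < M) then 1 else 0; let pl : Cfg → St → Fin 4 → Fin 4 → G := fun U x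 μ κ => U (x, μ) * U (sh x μ, κ) * (U (sh x κ, μ))⁻¹ * (U (x, κ))⁻¹; let act : Cfg → ℝ := fun U => β * ∑ x : St, ∑ q : {q : Fin 4 × Fin 4 // q.1 < q.2}, ins x q.1.1 q.1.2 * (r.ρ (pl U x q.1.1 q.1.2)).trace.re; let wgt : Cfg → ℝ := fun U => Real.exp (act U); let sf : Set Cfg := {U | ∀ (x : St) (q : {q : Fin 4 × Fin 4 // q.1 < q.2}), ins x q.1.1 q.1.2 = 1 → (r.N : ℝ) - (r.ρ (pl U x q.1.1 q.1.2)).trace.re ≤ η}; let χ : Cfg → ℝ := sf.indicator fun _ => 1; let Ex : (Cfg → ℝ) → ℝ := fun F => (∫ U, F U * (χ U * wgt U) ∂ν) / (∫ U, χ U * wgt U ∂ν); let σ : ℕ → Cfg → Cfg := fun n U p => U ((p.1.1 + n, p.1.2), p.2); ∀ c : ZMod L, let Loc := fun F : Cfg → ℝ => Measurable F ∧ (∀ U, |F U| ≤ 1) ∧ ∀ U U', (∀ p : St × Fin 4, (p.1.1 - c).val ≤ w → U p = U' p) → F U = F U'; ∀ F₁ F₂ : Cfg → ℝ, Loc F₁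 → Loc F₂ → ∀ n : ℕ, 2 * n < L → |Ex (fun U => F₁ U * F₂ (σ n U)) - Ex F₁ * Ex (fun U => F₂ (σ n U))| ≤ C * Real.exp (-(m * n)); ∀ M : ℕ, (∃ η₀ : ℝ, 0 < η₀ ∧ ∀ η : ℝ, 0 < η → η ≤ η₀ → ∃ β₀ m₀ : ℝ, 0 < m₀ ∧ ∀ β : ℝ, β₀ ≤ β → ∀ w : ℕ, ∃ C : ℝ, ∃ Lmin : ℕ, TubeSF M η β m₀ C w Lmin) → ∃ β₀ m₀ : ℝ, 0 < m₀ ∧ ∀ β : ℝ, β₀ ≤ β → ∀ w : ℕ, ∃ C : ℝ, ∃ Lmin : ℕ, Tube M β m₀ C w Lmin := by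
  sorry

/-- **Composition** — the two stubs BY NAME give the crux BY NAME: fix `G, r, M`, take the
small-field anchor at `M` from `stub_smallFieldAnchor` and feed it to `stub_largeFieldStability`.
(Registered form; the `example` below is the same glue with the stub statements as hypotheses.) -/
theorem FibreAnchor_of : FibreAnchor :=
  fun G _ _ _ _ hG r M => stub_largeFieldStability G hG r M (stub_smallFieldAnchor G hG r M)

/-- **The glue alone, `sorry`-free** (BC3 hypothesis form `S-statement → P-statement → FibreAnchor`;
this `example` does not mention the stubs, so any `sorry` here would be flagged — there is none). -/
example
    (hS : ∀ (G : Type) [Group G] [TopologicalSpace G] [IsTopologicalGroup G] [CompactSpace G], Literature.MathematicalPhysics.QuantumFieldTheory.IsCompactSimpleLieGroup G → letI : MeasurableSpace G := borel G; haveI : BorelSpace G := ⟨rfl⟩; ∀ r : Literature.MathematicalPhysics.QuantumFieldTheory.LatticeRep G, let TubeSF := fun (M : ℕ) (η β m C : ℝ) (w Lmin : ℕ) => ∀ (L : ℕ) [NeZero L], Lmin ≤ L → let St := ZMod L × ZMod L × Fin (M + 1) × Fin (M + 1); let Cfg := St × Fin 4 → G; let ν : MeasureTheory.Measure Cfg :=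 MeasureTheory.Measure.pi fun _ => Literature.MathematicalPhysics.QuantumFieldTheory.haarProbability G; let sh : St → Fin 4 → St := fun x μ => ![(x.1 + 1, x.2.1, x.2.2.1, x.2.2.2), (x.1, x.2.1 + 1, x.2.2.1, x.2.2.2), (x.1, x.2.1, x.2.2.1 + 1, x.2.2.2), (x.1, x.2.1, x.2.2.1, x.2.2.2 + 1)] μ; let ins : St → Fin 4 → Fin 4 → ℝ := fun x μ κ => if ((μ = 2 ∨ κ = 2) → (x.2.2.1 : ℕ) < M) ∧ ((μ = 3 ∨ κ = 3) → (x.2.2.2 : ℕ) < M) then 1 else 0; let pl : Cfg → St → Fin 4 → Fin 4 → G := fun U x μ κ => U (x, μ) * U (sh x μ, κ) * (U (sh x κ, μ))⁻¹ * (U (x, κ))⁻¹; let act : Cfg → ℝ := fun U => β * ∑ x : St, ∑ q : {q : Fin 4 × Fin 4 // q.1 < q.2}, ins x q.1.1 q.1.2 * (r.ρ (pl U x q.1.1 q.1.2)).trace.re; let wgt : Cfg → ℝ := fun U => Real.exp (act U); let sf : Set Cfg := {U | ∀ (x : St) (q : {q : Fin 4 × Fin 4 // q.1 < q.2}), ins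 x q.1.1 q.1.2 = 1 → (r.N : ℝ) - (r.ρ (pl U x q.1.1 q.1.2)).trace.re ≤ η}; let χ : Cfg → ℝ := sf.indicator fun _ => 1; let Ex : (Cfg → ℝ) → ℝ := fun F => (∫ U, F U * (χ U * wgt U) ∂ν) / (∫ U, χ U * wgt U ∂ν); let σ : ℕ → Cfg → Cfg := fun n U p => U ((p.1.1 + n, p.1.2), p.2); ∀ c : ZMod L, let Loc := fun F : Cfg → ℝ => Measurable F ∧ (∀ U, |F U| ≤ 1) ∧ ∀ U U', (∀ p : St × Fin 4, (p.1.1 - c).val ≤ w → U p = U' p) → F U = F U'; ∀ F₁ F₂ : Cfg → ℝ, Loc F₁ → Loc F₂ → ∀ n : ℕ, 2 * n < L → |Ex (fun U => F₁ U * F₂ (σ n U)) - Ex F₁ * Ex (fun U => F₂ (σ n U))| ≤ C * Real.exp (-(m * n)); ∀ M : ℕ, ∃ η₀ : ℝ, 0 < η₀ ∧ ∀ η : ℝ, 0 < η → η ≤ η₀ → ∃ β₀ m₀ : ℝ, 0 < m₀ ∧ ∀ β : ℝ, β₀ ≤ β → ∀ w : ℕ, ∃ C : ℝ, ∃ Lmin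 : ℕ, TubeSF M η β m₀ C w Lmin)
    (hP : ∀ (G : Type) [Group G] [TopologicalSpace G] [IsTopologicalGroup G] [CompactSpace G], Literature.MathematicalPhysics.QuantumFieldTheory.IsCompactSimpleLieGroup G → letI : MeasurableSpace G := borel G; haveI : BorelSpace G := ⟨rfl⟩; ∀ r : Literature.MathematicalPhysics.QuantumFieldTheory.LatticeRep G, let Tube := fun (M : ℕ) (β m C : ℝ) (w Lmin : ℕ) => ∀ (L : ℕ) [NeZero L], Lmin ≤ L → let St := ZMod L × ZMod L × Fin (M + 1) × Fin (M + 1); let Cfg := St × Fin 4 → G; let ν : MeasureTheory.Measure Cfg := MeasureTheory.Measure.pi fun _ => Literature.MathematicalPhysics.QuantumFieldTheory.haarProbability G; let sh : St → Fin 4 → St := fun x μ => ![(x.1 + 1, x.2.1, x.2.2.1, x.2.2.2), (x.1, x.2.1 + 1, x.2.2.1, x.2.2.2), (x.1, x.2.1, x.2.2.1 + 1, x.2.2.2), (x.1, x.2.1, x.2.2.1, x.2.2.2 + 1)] μ; let ins : St → Fin 4 → Fin 4 → ℝ := fun x μ κ => if ((μ = 2 ∨ κ = 2) → (x.2.2.1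 : ℕ) < M) ∧ ((μ = 3 ∨ κ = 3) → (x.2.2.2 : ℕ) < M) then 1 else 0; let pl : Cfg → St → Fin 4 → Fin 4 → G := fun U x μ κ => U (x, μ) * U (sh x μ, κ) * (U (sh x κ, μ))⁻¹ * (U (x, κ))⁻¹; let act : Cfg → ℝ := fun U => β * ∑ x : St, ∑ q : {q : Fin 4 × Fin 4 // q.1 < q.2}, ins x q.1.1 q.1.2 * (r.ρ (pl U x q.1.1 q.1.2)).trace.re; let wgt : Cfg → ℝ := fun U => Real.exp (act U); let Ex : (Cfg → ℝ) → ℝ := fun F => (∫ U, F U * wgt U ∂ν) / (∫ U, wgt U ∂ν); let σ : ℕ → Cfg → Cfg := fun n U p => U ((p.1.1 + n, p.1.2), p.2); ∀ c : ZMod L, let Loc := fun F : Cfg → ℝ => Measurable F ∧ (∀ U, |F U| ≤ 1) ∧ ∀ U U', (∀ p : St × Fin 4, (p.1.1 - c).val ≤ w → U p = U' p) → F U = F U'; ∀ F₁ F₂ : Cfg → ℝ, Loc F₁ → Loc F₂ → ∀ n : ℕ, 2 * n < L → |Ex (fun U => F₁ U * F₂ (σ n U)) - Ex F₁ * Ex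 (fun U => F₂ (σ n U))| ≤ C * Real.exp (-(m * n)); let TubeSF := fun (M : ℕ) (η β m C : ℝ) (w Lmin : ℕ) => ∀ (L : ℕ) [NeZero L], Lmin ≤ L → let St := ZMod L × ZMod L × Fin (M + 1) × Fin (M + 1); let Cfg := St × Fin 4 → G; let ν : MeasureTheory.Measure Cfg := MeasureTheory.Measure.pi fun _ => Literature.MathematicalPhysics.QuantumFieldTheory.haarProbability G; let sh : St → Fin 4 → St := fun x μ => ![(x.1 + 1, x.2.1, x.2.2.1, x.2.2.2), (x.1, x.2.1 + 1, x.2.2.1, x.2.2.2), (x.1, x.2.1, x.2.2.1 + 1, x.2.2.2), (x.1, x.2.1, x.2.2.1, x.2.2.2 + 1)] μ; let ins : St → Fin 4 → Fin 4 → ℝ := fun x μ κ => if ((μ = 2 ∨ κ = 2) → (x.2.2.1 : ℕ) < M) ∧ ((μ = 3 ∨ κ = 3) → (x.2.2.2 : ℕ) < M) then 1 else 0; let pl : Cfg → St → Fin 4 → Fin 4 → G := fun U x μ κ => U (x, μ) * U (sh x μ, κ) * (U (sh x κ, μ))⁻¹ * (U (x, κ))⁻¹; let act : Cfg → ℝ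 := fun U => β * ∑ x : St, ∑ q : {q : Fin 4 × Fin 4 // q.1 < q.2}, ins x q.1.1 q.1.2 * (r.ρ (pl U x q.1.1 q.1.2)).trace.re; let wgt : Cfg → ℝ := fun U => Real.exp (act U); let sf : Set Cfg := {U | ∀ (x : St) (q : {q : Fin 4 × Fin 4 // q.1 < q.2}), ins x q.1.1 q.1.2 = 1 → (r.N : ℝ) - (r.ρ (pl U x q.1.1 q.1.2)).trace.re ≤ η}; let χ : Cfg → ℝ := sf.indicator fun _ => 1; let Ex : (Cfg → ℝ) → ℝ := fun F => (∫ U, F U * (χ U * wgt U) ∂ν) / (∫ U, χ U * wgt U ∂ν); let σ : ℕ → Cfg → Cfg := fun n U p => U ((p.1.1 + n, p.1.2), p.2); ∀ c : ZMod L, let Loc := fun F : Cfg → ℝ => Measurable F ∧ (∀ U, |F U| ≤ 1) ∧ ∀ U U', (∀ p : St × Fin 4, (p.1.1 - c).val ≤ w → U p = U' p) → F U = F U'; ∀ F₁ F₂ : Cfg → ℝ, Loc F₁ → Loc F₂ → ∀ n : ℕ, 2 * n < L → |Ex (fun U => F₁ U * F₂ (σ n U)) - Ex F₁ * Ex (fun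 U => F₂ (σ n U))| ≤ C * Real.exp (-(m * n)); ∀ M : ℕ, (∃ η₀ : ℝ, 0 < η₀ ∧ ∀ η : ℝ, 0 < η → η ≤ η₀ → ∃ β₀ m₀ : ℝ, 0 < m₀ ∧ ∀ β : ℝ, β₀ ≤ β → ∀ w : ℕ, ∃ C : ℝ, ∃ Lmin : ℕ, TubeSF M η β m₀ C w Lmin) → ∃ β₀ m₀ : ℝ, 0 < m₀ ∧ ∀ β : ℝ, β₀ ≤ β → ∀ w : ℕ, ∃ C : ℝ, ∃ Lmin : ℕ, Tube M β m₀ C w Lmin) :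
    FibreAnchor :=
  fun G _ _ _ _ hG r M => hP G hG r M (hS G hG r M)

/-- Signature match: the registered composition has literally the route's crux as its type. -/
example : Summit.QuantumFields.YangMills.Theses.ContractibleFibre.FibreAnchor := FibreAnchor_of

end Summit.QuantumFields.YangMills.Cruxes.FibreAnchor.Birth

end
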